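import Mathlib
import Summits.NavierStokesRegularity.NavierStokesRegularity.Theses.RobustBlowupPortability
import Summits.NavierStokesRegularity.NavierStokesRegularity.Theorems.TypeICertificateLadderNoBlowupToClay
import Literature.Analysis.FluidPDE.ClayClassLerayHopfUniqueness
import Literature.Analysis.FluidPDE.TaoFiniteEnergyLerayHopf
import HarnessLib

/-!
# `RobustBlowupPortability.GlobalFromNoBlowup` — no blow-up ⇒ classical Leray–Hopf solutions on every
  closed slab (route `RobustBlowupPortability`, item stmt-NavierStokesRegularity-2927, support)

**Statement.** If no maximal smooth solution with finite-energy rapidly decaying Clay data exists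
(¬X5a), then for every `ν > 0`, every smooth divergence-free rapidly decaying datum `u₀` and every
`T > 0` there is a classical solution `(u, p)` on the CLOSED slab `[0, T]`, Leray–Hopf from `u₀`,
`u 0 = u₀`.

PROOF. ¬X5a is `NoBlowup` (every classical Leray–Hopf solution from a rapidly decaying datum extends
past its endpoint); the landed `typeICertificateLadder_noBlowupToClay_proof` (stmt-0055) turns it into
Clay (A): a global smooth solution with bounded energy. Its restriction to `[0, T]` is classical
(`IsNavierStokesSolution.isClassicalNSSolutionOn_Icc`) and, being of finite energy, Leray–Hopf from
`u 0 = u₀` (Tao 2013, Lemma 8.1: the tree's `isLerayHopfOn_of_finiteEnergy`).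

HONEST FRAMING: a conditional bookkeeping statement; nothing here bears on the regularity problem
itself.
-/

noncomputable section

set_option linter.dupNamespace false

namespace Summit.NavierStokesRegularity.NavierStokesRegularity.Theorems

open MeasureTheory Set
open scoped ENNReal
open Literature.Analysis Literature.Analysis.FluidPDE

/-- **Item stmt-NavierStokesRegularity-2927** (`RobustBlowupPortability.GlobalFromNoBlowup`): ¬X5a ⇒
classical Leray–Hopf solutions on every closed slab `[0, T]` (NoBlowupToClay + Tao's Lemma 8.1).
[this file] -/
theorem robustBlowupPortability_globalFromNoBlowup_proof :
    Summit.NavierStokesRegularity.NavierStokesRegularity.Theses.RobustBlowupPortability.GlobalFromNoBlowup := by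
  unfold Summit.NavierStokesRegularity.NavierStokesRegularity.Theses.RobustBlowupPortability.GlobalFromNoBlowup
  intro hNB ν hν u₀ hsm hdiv hdec T hT
  -- ¬X5a ⇒ Clay (A)
  have hClay : _root_.NavierStokesRegularity := by
    refine typeICertificateLadder_noBlowupToClay_proof ?_
    intro ν' T' hν' hT' u p hcl hLH hdec'
    by_contra hext
    exact hNB ⟨ν', hν', T', hT', u, p, ⟨hcl, hext⟩, hLH, hdec'⟩
  obtain ⟨U, P, hU, hP, hns, hE⟩ := hClay ν hν u₀ hsm (fun x => hdiv x) hdec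
  -- restriction to the closed slab
  have hcl : IsClassicalNSSolutionOn (Icc 0 T) ν 0 U P := hns.isClassicalNSSolutionOn_Icc hU hP hT
  have hfe : ∃ A : ℝ≥0∞, A < ⊤ ∧ ∀ t ∈ Icc 0 T, ∫⁻ x, ‖U t x‖ₑ ^ 2 ≤ A := by
    obtain ⟨C, hC, hb⟩ := hE
    exact ⟨C, hC, fun t ht => hb t ht.1⟩
  have hLH := (isLerayHopfOn_of_finiteEnergy hcl hν hT hfe).1
  have h0 : U 0 = u₀ := hns.initial
  refine ⟨U, P, hcl, ?_, h0⟩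
  rw [← h0]
  exact hLH

end Summit.NavierStokesRegularity.NavierStokesRegularity.Theorems

end
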